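import Summits.Ventures.PercRepro.RLSRuleCoreLines
import Summits.Ventures.PercRepro.RLSRuleTypeTools

/-!
# C-025 at q = 3: `R₃⁺` on an ARBITRARY plane of the core — the shares of a witness (night-3, gen 4)

On a core matroid (no `4`-point line) the traces of a witness `B′ ∪ X` (`B′ ⊆ G` of rank `3`, `X` independent,
off `G`, inside `K ⊆ E ∖ G`) are controlled by the `3`-point lines of `G` alone:

* `card_inter_le_three_of_core`: a plane `G′ ≠ G` meets `G` in at most `3` points, and in `3` only along a line
  (`inter_eq_dep_triple_of_three_le`); `eRk_eq_three_of_four_le_of_core`: every subset of `G` with `≥ 4` points has rank `3`;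
* `card_trace_le_five_of_good`: in a witness good for the lines inside `B′` (no coplanar triple of such a line
  inside `X`) every trace of another plane has `≤ 5` points;
* **`wPlus_eq_one_of_seven_le`** (the WINNER share): a rank-`3` subset with `≥ 7` points takes the whole witness,
  **`wPlus_eq_one_of_six_good`**: a `6`-point subset takes every good witness;
* **`wPlus_ge_of_good_exact`** / **`wPlus_ge_of_good`**: a `𝒯₀` subset (`≤ 5` points) receives
  `ρ₃(B′)/(C(b + x, 3) − #dep(B′))`, hence `ρ₃(B′)/C(b + x, 3)`, in every good witness.
This is the geometric half of the lane on the large planes; the accounting is `RLSRuleProfileSums`.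
Imports `RLSRuleCoreLines`, `RLSRuleTypeTools`.  Axioms: standard.
-/

open scoped Matroid

namespace PercRepro

namespace NightThree

open Finset ThmH PerFlat

variable {α : Type*} [DecidableEq α] {M : Matroid α} [M.Finite]

/-- On the core every subset of a plane with at least `4` points has rank `3`. -/
theorem eRk_eq_three_of_four_le_of_core {p : ℕ} (hc : Core M p) {G B : Finset α} (hG : G ∈ flatsQ M 3)
    (hB : B ⊆ G) (h4 : 4 ≤ B.card) : M.eRk (B : Set α) = 3 := by
  have hG3 : M.eRk (G : Set α) = 3 := eRk_eq_three_of_mem_flatsQ' hG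
  have hGE : G ⊆ gr M := (mem_flatsQ.1 hG).1
  apply le_antisymm
  · rw [← hG3]; exact M.eRk_mono (Finset.coe_subset.2 hB)
  · by_contra hlt
    push Not at hlt
    obtain ⟨L, hLB, hLc⟩ := Finset.exists_subset_card_eq h4
    obtain ⟨k, hk, _⟩ := eRk_eq_nat M B
    have hk2 : k ≤ 2 := by
      rw [hk] at hlt
      have : k < 3 := by exact_mod_cast hlt
      omega
    have hLr : M.eRk (L : Set α) ≤ 2 := by
      have h1 : M.eRk (L : Set α) ≤ M.eRk (B : Set α) := M.eRk_mono (Finset.coe_subset.2 hLB)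
      rw [hk] at h1
      exact h1.trans (by exact_mod_cast hk2)
    exact not_hasLongLine_of_core hc hGE ⟨L, Finset.mem_powersetCard.2 ⟨hLB.trans hB, hLc⟩, hLr⟩

/-- A subset of a plane of the core with rank `≤ 2` has at most `3` points. -/
theorem card_le_three_of_eRk_le_two_of_core {p : ℕ} (hc : Core M p) {G B : Finset α} (hG : G ∈ flatsQ M 3)
    (hB : B ⊆ G) (hr : M.eRk (B : Set α) ≤ 2) : B.card ≤ 3 := by
  by_contra h
  push Not at h
  have := eRk_eq_three_of_four_le_of_core hc hG hB (by omega)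
  rw [this] at hr
  exact absurd hr (by decide)

/-- On the core a plane `G′ ≠ G` meets `G` in at most `3` points. -/
theorem card_inter_le_three_of_core {p : ℕ} (hc : Core M p) {G G' : Finset α} (hG : G ∈ flatsQ M 3)
    (hG' : G' ∈ flatsQ M 3) (hne : G' ≠ G) : (G' ∩ G).card ≤ 3 := by
  apply card_le_three_of_eRk_le_two_of_core hc hG Finset.inter_subset_right
  by_contra h
  push Not at h
  have h3 : M.eRk ((G' ∩ G : Finset α) : Set α) = 3 := by
    apply le_antisymm
    · rw [← eRk_eq_three_of_mem_flatsQ' hG]; exact M.eRk_mono (Finset.coe_subset.2 Finset.inter_subset_right)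
    · exact Order.add_one_le_of_lt h
  rw [flatsQ_three] at hG hG'
  exact hne (planes_eq_of_subset hG' hG Finset.inter_subset_left Finset.inter_subset_right h3)

/-- A `3`-point subset of a plane of the core meeting another plane is a dependent triple (a `3`-point line). -/
theorem mem_depTriples_of_inter {G G' : Finset α} (hG : G ∈ flatsQ M 3)
    (hG' : G' ∈ flatsQ M 3) (hne : G' ≠ G) (h3 : (G' ∩ G).card = 3) : G' ∩ G ∈ depTriples M G := by
  classical
  unfold depTriples
  rw [Finset.mem_filter, Finset.mem_powersetCard]
  refine ⟨⟨Finset.inter_subset_right, h3⟩, ?_⟩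
  intro hind
  have hr : M.eRk ((G' ∩ G : Finset α) : Set α) = 3 := by
    rw [eRk_eq_card_of_indep hind, h3]; rfl
  rw [flatsQ_three] at hG hG'
  exact hne (planes_eq_of_subset hG' hG Finset.inter_subset_left Finset.inter_subset_right hr)

/-- **Traces in a good witness.**  On the core, for `B′ ⊆ G`, `X ⊆ K` independent, and `X` good for every
dependent triple of `G` inside `B′`, every plane `G′ ≠ G` meets `B′ ∪ X` in at most `5` points. -/
theorem card_trace_le_five_of_good {p : ℕ} (hc : Core M p) {G K B X G' : Finset α} (hG : G ∈ flatsQ M 3)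
    (hB : B ⊆ G) (hX : M.Indep (X : Set α)) (hXK : X ⊆ K)
    (hgood : ∀ ℓ ∈ depTriples M G, ℓ ⊆ B → GoodWitness M ℓ K X)
    (hG' : G' ∈ flatsQ M 3) (hne : G' ≠ G) : (G' ∩ (B ∪ X)).card ≤ 5 := by
  classical
  have hsplit : (G' ∩ (B ∪ X)).card ≤ (G' ∩ B).card + (G' ∩ X).card := by
    rw [Finset.inter_union_distrib_left]; exact Finset.card_union_le _ _
  have hGB : (G' ∩ B).card ≤ (G' ∩ G).card := Finset.card_le_card (Finset.inter_subset_inter_left hB)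
  have hG3 := card_inter_le_three_of_core hc hG hG' hne
  have hGX : (G' ∩ X).card ≤ 3 := by
    have hind : M.Indep ((G' ∩ X : Finset α) : Set α) := hX.subset (Finset.coe_subset.2 Finset.inter_subset_right)
    have hle3 : M.eRk ((G' ∩ X : Finset α) : Set α) ≤ 3 := by
      rw [← eRk_eq_three_of_mem_flatsQ' hG']
      exact M.eRk_mono (Finset.coe_subset.2 Finset.inter_subset_left)
    rw [eRk_eq_card_of_indep hind] at hle3
    exact_mod_cast hle3
  rcases Nat.lt_or_ge (G' ∩ B).card 3 with hlt | hge
  · omega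
  · -- `G′ ∩ B = G′ ∩ G` is a dependent triple `ℓ ⊆ B`; a `3`-point `G′ ∩ X` would be its coplanar triple
    have h3 : (G' ∩ G).card = 3 := by omega
    have heq : G' ∩ B = G' ∩ G :=
      Finset.eq_of_subset_of_card_le (Finset.inter_subset_inter_left hB) (by omega)
    have hℓ : G' ∩ G ∈ depTriples M G := mem_depTriples_of_inter hG hG' hne h3
    have hℓB : G' ∩ G ⊆ B := by rw [← heq]; exact Finset.inter_subset_right
    have hGX2 : (G' ∩ X).card ≤ 2 := by
      by_contra hc3
      push Not at hc3
      have hc3' : (G' ∩ X).card = 3 := by omega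
      apply hgood (G' ∩ G) hℓ hℓB (G' ∩ X)
      · unfold coplanarTriples
        rw [Finset.mem_filter, Finset.mem_powersetCard]
        refine ⟨⟨Finset.inter_subset_right.trans hXK, hc3'⟩, ?_⟩
        rw [← eRk_eq_three_of_mem_flatsQ' hG']
        apply M.eRk_mono
        rw [Finset.coe_union]
        apply Set.union_subset
        · rw [Finset.coe_inter]; exact Set.inter_subset_left
        · rw [Finset.coe_inter]; exact Set.inter_subset_left
      · exact Finset.inter_subset_right
    omega

/-- On the core a trace `G ∩ S` with at least `6` points is outside `𝒯₀` (rank `3` by `eRk_eq_three_of_four_le_of_core`). -/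
theorem nonT0_of_six_le {p : ℕ} (hc : Core M p) {G B : Finset α} (hG : G ∈ flatsQ M 3) (hB : B ⊆ G)
    (h6 : 6 ≤ B.card) : NonT0 M B :=
  ⟨eRk_eq_three_of_four_le_of_core hc hG hB (by omega), Or.inl h6⟩

/-- If `G`'s trace is outside `𝒯₀` and strictly larger than every other plane's trace, then `G` is the unique tied
plane and `m*(S)` is its trace size. -/
theorem tied_eq_singleton_of_max {G S : Finset α} (hG : G ∈ flatsQ M 3) (hn : NonT0 M (G ∩ S))
    (hmax : ∀ G' ∈ flatsQ M 3, G' ≠ G → (G' ∩ S).card < (G ∩ S).card) :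
    G ∈ tied M S ∧ ∀ G' ∈ tied M S, G' = G := by
  classical
  have hm : mstar M S = (G ∩ S).card := by
    unfold mstar
    apply le_antisymm
    · apply Finset.sup_le
      intro G' hG'
      rw [Finset.mem_filter] at hG'
      by_cases h : G' = G
      · rw [h]
      · exact (hmax G' hG'.1 h).le
    · exact Finset.le_sup (f := fun G => (G ∩ S).card) (Finset.mem_filter.2 ⟨hG, hn⟩)
  refine ⟨mem_tied.2 ⟨hG, hn, hm.symm⟩, ?_⟩
  intro G' hG'
  rw [mem_tied] at hG'
  by_contra h
  have := hmax G' hG'.1 h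
  rw [hG'.2.2, hm] at this
  exact lt_irrefl _ this

/-- **The winner share.**  On the core a rank-`3` subset `B′ ⊆ G` with at least `7` points takes every witness
`B′ ∪ X` whole: no other plane can reach `7` points in it. -/
theorem wPlus_eq_one_of_seven_le {p : ℕ} (hc : Core M p) {G B X : Finset α} (hG : G ∈ flatsQ M 3)
    (hB : B ⊆ G) (h7 : 7 ≤ B.card) (hX : M.Indep (X : Set α)) (hXG : Disjoint X G) :
    wPlus M G (B ∪ X) = 1 := by
  have hS : B ∪ X ⊆ gr M := by
    apply Finset.union_subset (hB.trans (mem_flatsQ.1 hG).1)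
    rw [← Finset.coe_subset, coe_gr]
    exact hX.subset_ground
  have hGS : G ∩ (B ∪ X) = B := inter_union_eq_of_disjoint hB hXG
  have hmax : ∀ G' ∈ flatsQ M 3, G' ≠ G → (G' ∩ (B ∪ X)).card < (G ∩ (B ∪ X)).card := by
    intro G' hG' hne
    rw [hGS]
    have h1 := card_inter_union_le (B := B) (X := X) hG' hX
    have h2 : (G' ∩ B).card ≤ 3 :=
      (Finset.card_le_card (Finset.inter_subset_inter_left hB)).trans (card_inter_le_three_of_core hc hG hG' hne)
    omega
  obtain ⟨htied, huniq⟩ := tied_eq_singleton_of_max hG (by rw [hGS]; exact nonT0_of_six_le hc hG hB (by omega)) hmax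
  exact wPlus_eq_one_of_unique hS htied huniq

/-- **The `6`-point share.**  On the core a `6`-point subset `B′ ⊆ G` takes every witness good for the lines inside
it (the only `6`-point competitors are `ℓ ∪ C` with `C` a coplanar triple of a line `ℓ ⊆ B′`). -/
theorem wPlus_eq_one_of_six_good {p : ℕ} (hc : Core M p) {G K B X : Finset α} (hG : G ∈ flatsQ M 3)
    (hB : B ⊆ G) (h6 : B.card = 6) (hX : M.Indep (X : Set α)) (hXG : Disjoint X G) (hXK : X ⊆ K)
    (hgood : ∀ ℓ ∈ depTriples M G, ℓ ⊆ B → GoodWitness M ℓ K X) :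
    wPlus M G (B ∪ X) = 1 := by
  have hS : B ∪ X ⊆ gr M := by
    apply Finset.union_subset (hB.trans (mem_flatsQ.1 hG).1)
    rw [← Finset.coe_subset, coe_gr]
    exact hX.subset_ground
  have hGS : G ∩ (B ∪ X) = B := inter_union_eq_of_disjoint hB hXG
  have hmax : ∀ G' ∈ flatsQ M 3, G' ≠ G → (G' ∩ (B ∪ X)).card < (G ∩ (B ∪ X)).card := by
    intro G' hG' hne
    rw [hGS, h6]
    have := card_trace_le_five_of_good hc hG hB hX hXK hgood hG' hne
    omega
  obtain ⟨htied, huniq⟩ := tied_eq_singleton_of_max hG (by rw [hGS]; exact nonT0_of_six_le hc hG hB (by omega)) hmax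
  exact wPlus_eq_one_of_unique hS htied huniq

/-- In a good witness of a `𝒯₀` subset every trace is in `𝒯₀`. -/
theorem mstar_union_eq_zero_of_good' {p : ℕ} (hc : Core M p) {G K B X : Finset α} (hG : G ∈ flatsQ M 3)
    (hB : B ⊆ G) (h5 : B.card ≤ 5) (hX : M.Indep (X : Set α)) (hXG : Disjoint X G) (hXK : X ⊆ K)
    (hgood : ∀ ℓ ∈ depTriples M G, ℓ ⊆ B → GoodWitness M ℓ K X) : mstar M (B ∪ X) = 0 := by
  have hGE : G ⊆ gr M := (mem_flatsQ.1 hG).1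
  rw [mstar_eq_zero_iff]
  intro G' hG' hn
  obtain ⟨_, hbig⟩ := hn
  rcases hbig with h6 | hline
  · by_cases hGG : G' = G
    · rw [hGG, inter_union_eq_of_disjoint hB hXG] at h6
      omega
    · have := card_trace_le_five_of_good hc hG hB hX hXK hgood hG' hGG
      omega
  · exact not_hasLongLine_of_core hc (hB.trans hGE)
      (hasLongLine_of_union hG (simpleOn_of_core hc hGE) hB hX hXG Finset.inter_subset_right hline)

open scoped Classical in
/-- **The exact `𝒯₀` share.**  In a good witness a subset `B′ ⊆ G` with `≤ 5` points receives at least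
`ρ₃(B′)/(C(b + x, 3) − #dep(B′))`. -/
theorem wPlus_ge_of_good_exact {p : ℕ} (hc : Core M p) {G K B X : Finset α} (hG : G ∈ flatsQ M 3)
    (hB : B ⊆ G) (h5 : B.card ≤ 5) (hX : M.Indep (X : Set α)) (hXG : Disjoint X G) (hXK : X ⊆ K)
    (hgood : ∀ ℓ ∈ depTriples M G, ℓ ⊆ B → GoodWitness M ℓ K X) :
    (rho3 M B : ℚ) / ((((B.card + X.card).choose 3 : ℕ) : ℚ) -
        (((B.powersetCard 3).filter (fun (T : Finset α) => ¬ M.Indep (T : Set α))).card : ℚ)) ≤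
      wPlus M G (B ∪ X) := by
  classical
  have hS : B ∪ X ⊆ gr M := by
    apply Finset.union_subset (hB.trans (mem_flatsQ.1 hG).1)
    rw [← Finset.coe_subset, coe_gr]
    exact hX.subset_ground
  have hm := mstar_union_eq_zero_of_good' hc hG hB h5 hX hXG hXK hgood
  have hle := rho3_add_card_dep_le_choose (M := M) (S := B ∪ X) (B := B) Finset.subset_union_left
  have hdisj : Disjoint B X := (Finset.disjoint_of_subset_right hB hXG).symm
  have hD : (rho3 M (B ∪ X) : ℚ) ≤ (((B.card + X.card).choose 3 : ℕ) : ℚ) -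
      (((B.powersetCard 3).filter (fun (T : Finset α) => ¬ M.Indep (T : Set α))).card : ℚ) := by
    rw [← Finset.card_union_of_disjoint hdisj]
    have h2 : ((rho3 M (B ∪ X) : ℕ) : ℚ) +
        (((B.powersetCard 3).filter (fun (T : Finset α) => ¬ M.Indep (T : Set α))).card : ℚ) ≤
        (((B ∪ X).card.choose 3 : ℕ) : ℚ) := by exact_mod_cast hle
    linarith
  have hw := wPlus_ge_of_mstar_zero' hS hm G hD
  rw [inter_union_eq_of_disjoint hB hXG] at hw
  exact hw

/-- **The crude `𝒯₀` share.**  In a good witness a subset `B′ ⊆ G` with `≤ 5` points receives at least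
`ρ₃(B′)/C(b + x, 3)`. -/
theorem wPlus_ge_of_good {p : ℕ} (hc : Core M p) {G K B X : Finset α} (hG : G ∈ flatsQ M 3)
    (hB : B ⊆ G) (h5 : B.card ≤ 5) (hX : M.Indep (X : Set α)) (hXG : Disjoint X G) (hXK : X ⊆ K)
    (hgood : ∀ ℓ ∈ depTriples M G, ℓ ⊆ B → GoodWitness M ℓ K X) :
    (rho3 M B : ℚ) / (((B.card + X.card).choose 3 : ℕ) : ℚ) ≤ wPlus M G (B ∪ X) := by
  have hS : B ∪ X ⊆ gr M := by
    apply Finset.union_subset (hB.trans (mem_flatsQ.1 hG).1)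
    rw [← Finset.coe_subset, coe_gr]
    exact hX.subset_ground
  have hm := mstar_union_eq_zero_of_good' hc hG hB h5 hX hXG hXK hgood
  have hw := wPlus_ge_of_mstar_zero hS hm G
  rw [inter_union_eq_of_disjoint hB hXG,
    Finset.card_union_of_disjoint (Finset.disjoint_of_subset_right hB hXG).symm] at hw
  exact hw

end NightThree

end PercRepro
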